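import Summits.CriticalPhenomena.SAWScalingLimit.Theorems.SAWDefectDecoherenceBoundaryClosureRGateDbarLimit
import HarnessLib

/-!
# Polygon Green pairing, II: the twisted term and the Taylor remainder at one mesh, vertex form
(crux `BoundaryClosureR`, stmt-CriticalPhenomena-14004, line `polygon-parity-squeeze`, registered
stub `polygonGreenPairing`, mechanism (A1a))

One-mesh estimates for two of the three error terms of the Taylor-expanded discrete Green identity
(`HexObservableLimitR.greenLimit_identity`, DCS Lemma 1 summed against `φ(δ c_v)`):
`N_δ(∂̄φ) − 6δ·(dart sum) = −T_δ(∂φ) − 6 E_δ + Q_δ`, for a GENERAL domain `Λ` (no pin is used here;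
compare the gate case `…GateDbarTwisted.lean`, `…GateDbarRemainder.lean`):

* `twisted_vertex_le` — the twisted term `T_δ(ψ)` is at most `6δ²/‖F(b)‖ Σ_v (‖ψ‖_∞ ‖S_v‖ + (L_ψ δ/4)·starMass(v))`
  over the vertices with scaled centre `δ/2`-close to `supp ψ`, `S_v = Σ_t conj(mid − c_v) F({v,t})` the
  conjugated star sum of `DefectDecoherence` (regroup by both endpoints, freeze `ψ` at the centre;
  registered form `polygonGreen_twistedVertex`);
* `twistWeight_le_of_isMetricDepth`, `twistWeight_le_of_deep` — `DefectDecoherence` at a vertex of metric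
  depth `k` (radius `(k+1)/2`) resp. at an `R`-deep vertex turns the vertex functional into
  `(‖ψ‖_∞ A₀ (k+1)^{-θ} + L_ψ δ/4)·starMass` resp. `(‖ψ‖_∞ C R^{-θ} + L_ψ δ/4)·starMass`;
* `remainder_vertex_le` — the mass in the Taylor remainder (`greenLimit_remainder_norm_le`) is at most
  `δ²/‖F(b)‖ Σ_v starMass(v)` over the vertices with scaled centre `(r + δ/2)`-close to `supp φ`.

Reference: Duminil-Copin–Smirnov, Ann. of Math. 175 (2012), §3 (Lemma 1, summation by parts).
-/

noncomputable section

open scoped BigOperators Topology Classical ComplexConjugate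
open Filter Set Metric Complex
open Literature.Probability.LatticeModels Literature.Probability.RandomPlanarGeometry
open Literature.Probability.RandomPlanarGeometry.SAW
open Literature.Barriers.CriticalPhenomena.HexGreen (nbrs mem_nbrs_iff)
open Summit.CriticalPhenomena.SAWScalingLimit.Theorems.PickHalfPlane
open Summit.CriticalPhenomena.SAWScalingLimit.Theorems.ObservableToSLE.FloorRatio (dist_smul_mesh)
open Summit.CriticalPhenomena.SAWScalingLimit.Theorems.DecoherenceSynthesis (norm_hexMidpoint_sub_hexCenter_le)
open Summit.CriticalPhenomena.SAWScalingLimit.Theorems.PolygonParitySqueeze.GateDbar (twisted_regroup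
  norm_vertexTwist_le norm_conjStar_sub_le)

namespace Summit.CriticalPhenomena.SAWScalingLimit.Theorems.PolygonParitySqueeze.PolygonGreen

/-! ### 1. The twisted term, reduced to a vertex functional -/

/-- **The twisted term at one mesh, vertex form.** For `ψ` bounded by `Mψ`, `L`-Lipschitz and vanishing
off `S`: `‖Σ_{up edges} 12(mid − c_v)² ψ(δ mid) δ²F/F(b)‖ ≤ 6 (δ²/‖F(b)‖) Σ_{v ∈ Λ, δ c_v ∈ S_{δ/2}}
(Mψ ‖S_v‖ + (Lδ/4) starMass(v))`, `S_v` the conjugated star sum, `S_{δ/2}` the closed `δ/2`-thickening.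
[cite: DuminilCopinSmirnov2012, §3 (summation by parts)] -/
theorem twisted_vertex_le (Λ : Finset HexVertex) (a b : Sym2 HexVertex) {δ : ℝ} (hδ : 0 ≤ δ)
    {ψ : ℂ → ℂ} {Mψ L : ℝ} {S : Set ℂ} (hMψ : ∀ z, ‖ψ z‖ ≤ Mψ) (hL : 0 ≤ L)
    (hψL : ∀ x y, ‖ψ x - ψ y‖ ≤ L * ‖x - y‖) (hψs : ∀ z, ψ z ≠ 0 → z ∈ S) :
    ‖∑ v ∈ Λ.filter (fun v => v.2 = 0), ∑ t ∈ Λ.filter (fun t => hexGraph.Adj v t),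
        12 * (hexMidpoint s(v, t) - hexCenter v) ^ 2 * ψ ((δ : ℂ) * hexMidpoint s(v, t)) *
          ((δ : ℂ) ^ 2 * hexParafermionicObservable Λ a hexCriticalFugacity (5 / 8) s(v, t) /
            hexParafermionicObservable Λ a hexCriticalFugacity (5 / 8) b)‖ ≤
      6 * (δ ^ 2 / ‖hexParafermionicObservable Λ a hexCriticalFugacity (5 / 8) b‖) *
        ∑ v ∈ Λ.filter (fun v => (δ : ℂ) * hexCenter v ∈ cthickening (δ / 2) S),
          (Mψ * ‖∑ t ∈ Λ.filter (fun t => hexGraph.Adj v t), conj (hexMidpoint s(v, t) - hexCenter v) *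
              hexParafermionicObservable Λ a hexCriticalFugacity (5 / 8) s(v, t)‖ +
            L * δ / 4 * starMass Λ a v) := by
  set F : Sym2 HexVertex → ℂ := hexParafermionicObservable Λ a hexCriticalFugacity (5 / 8) with hFdef
  set Fb : ℂ := F b with hFbdef
  set Φ : HexVertex → ℝ := fun v => Mψ * ‖∑ t ∈ Λ.filter (fun t => hexGraph.Adj v t),
    conj (hexMidpoint s(v, t) - hexCenter v) * F s(v, t)‖ + L * δ / 4 * starMass Λ a v with hΦ
  have hMψ0 : 0 ≤ Mψ := (norm_nonneg _).trans (hMψ 0)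
  have hstar : ∀ v, ∑ t ∈ Λ.filter (fun t => hexGraph.Adj v t), ‖F s(v, t)‖ ≤ starMass Λ a v :=
    fun v => Finset.sum_le_sum fun t _ => GateMass.norm_obs_le_norm_obs_zero Λ a (5 / 8) s(v, t)
  rw [twisted_regroup]
  set W : HexVertex → ℝ := fun v =>
    if (δ : ℂ) * hexCenter v ∈ cthickening (δ / 2) S then Φ v else 0 with hW
  have hvertex : ∀ v ∈ Λ, ‖∑ t ∈ Λ.filter (fun t => hexGraph.Adj v t),
      6 * (hexMidpoint s(v, t) - hexCenter v) ^ 2 * ψ ((δ : ℂ) * hexMidpoint s(v, t)) *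
        ((δ : ℂ) ^ 2 * F s(v, t) / Fb)‖ ≤ 6 * (δ ^ 2 / ‖Fb‖) * W v := by
    intro v _
    by_cases hvS : (δ : ℂ) * hexCenter v ∈ cthickening (δ / 2) S
    swap
    · -- far from the support every `ψ(δ mid)` vanishes
      have h0 : ∀ t ∈ Λ.filter (fun t => hexGraph.Adj v t),
          6 * (hexMidpoint s(v, t) - hexCenter v) ^ 2 * ψ ((δ : ℂ) * hexMidpoint s(v, t)) *
            ((δ : ℂ) ^ 2 * F s(v, t) / Fb) = 0 := by
        intro t ht
        have hadj : hexGraph.Adj v t := (Finset.mem_filter.1 ht).2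
        have hψ0 : ψ ((δ : ℂ) * hexMidpoint s(v, t)) = 0 := by
          by_contra hne
          apply hvS
          refine mem_cthickening_of_dist_le _ _ _ _ (hψs _ hne) ?_
          rw [dist_comm, dist_smul_mesh hδ, dist_eq_norm]
          exact (mul_le_mul_of_nonneg_left (norm_hexMidpoint_sub_hexCenter_le hadj) hδ).trans (by linarith)
        rw [hψ0]; ring
      rw [Finset.sum_eq_zero h0, norm_zero, hW]
      simp only [if_neg hvS, mul_zero]; exact le_rfl
    have hWv : W v = Φ v := by simp only [hW, if_pos hvS]
    rw [hWv]
    refine (norm_vertexTwist_le Λ F Fb δ ψ v).trans (mul_le_mul_of_nonneg_left ?_ (by positivity))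
    set Sv : ℂ := ∑ t ∈ Λ.filter (fun t => hexGraph.Adj v t), conj (hexMidpoint s(v, t) - hexCenter v) * F s(v, t)
      with hSv
    have hfreeze := norm_conjStar_sub_le Λ F hδ hL hψL v
    rw [← hSv] at hfreeze
    calc ‖∑ t ∈ Λ.filter (fun t => hexGraph.Adj v t),
          conj (hexMidpoint s(v, t) - hexCenter v) * ψ ((δ : ℂ) * hexMidpoint s(v, t)) * F s(v, t)‖
        ≤ ‖ψ ((δ : ℂ) * hexCenter v) * Sv‖ + L * δ / 4 * ∑ t ∈ Λ.filter (fun t => hexGraph.Adj v t), ‖F s(v, t)‖ :=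
          (norm_le_norm_add_norm_sub' _ (ψ ((δ : ℂ) * hexCenter v) * Sv)).trans (by linarith [hfreeze])
      _ ≤ Mψ * ‖Sv‖ + L * δ / 4 * starMass Λ a v := by
          rw [norm_mul]
          gcongr
          · exact hMψ _
          · exact hstar v
  have hsum := (norm_sum_le _ _).trans (Finset.sum_le_sum hvertex)
  refine hsum.trans (le_of_eq ?_)
  rw [← Finset.mul_sum, Finset.sum_filter]

/-! ### 2. `DefectDecoherence` at a vertex: the twist weights -/

/-- **Twist weight at metric depth `k`.** If the `DefectDecoherence` inequality with constants
`(C, θ)` holds at `Λ` (root `a`), then at a vertex of metric depth `k`: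
`Mψ ‖S_v‖ + (Lδ/4) starMass ≤ (Mψ · max(1/2, C 2^θ) · (k+1)^{-θ} + Lδ/4) · starMass` (depth `0`: the
trivial bound `‖S_v‖ ≤ starMass/2`; depth `k ≥ 1`: decoherence at radius `(k+1)/2 ∈ [1, k]`).
[cite: DuminilCopinSmirnov2012, §3 (summation by parts)] -/
theorem twistWeight_le_of_isMetricDepth {Λ : Finset HexVertex} {a : Sym2 HexVertex} {C θ : ℝ}
    (hDD : ∀ (v : HexVertex) (R : ℝ), 1 ≤ R →
      (∀ y : HexVertex, dist (hexCenter y) (hexCenter v) ≤ R → y ∈ Λ) →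
      ‖∑ t ∈ Λ.filter (fun t => hexGraph.Adj v t), conj (hexMidpoint s(v, t) - hexCenter v) *
          hexParafermionicObservable Λ a hexCriticalFugacity (5 / 8) s(v, t)‖ ≤
        C * R ^ (-θ) * ∑ t ∈ Λ.filter (fun t => hexGraph.Adj v t),
          ‖hexParafermionicObservable Λ a hexCriticalFugacity 0 s(v, t)‖)
    {Mψ L δ : ℝ} (hMψ : 0 ≤ Mψ) {v : HexVertex} {k : ℕ} (hk : IsMetricDepth Λ v k) :
    Mψ * ‖∑ t ∈ Λ.filter (fun t => hexGraph.Adj v t), conj (hexMidpoint s(v, t) - hexCenter v) *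
        hexParafermionicObservable Λ a hexCriticalFugacity (5 / 8) s(v, t)‖ + L * δ / 4 * starMass Λ a v ≤
      (Mψ * max (1 / 2) (C * 2 ^ θ) * ((k : ℝ) + 1) ^ (-θ) + L * δ / 4) * starMass Λ a v := by
  set Sv : ℂ := ∑ t ∈ Λ.filter (fun t => hexGraph.Adj v t), conj (hexMidpoint s(v, t) - hexCenter v) *
    hexParafermionicObservable Λ a hexCriticalFugacity (5 / 8) s(v, t) with hSv
  have hstar0 : 0 ≤ starMass Λ a v := Finset.sum_nonneg fun t _ => norm_nonneg _
  have hSbound : ‖Sv‖ ≤ max (1 / 2) (C * 2 ^ θ) * ((k : ℝ) + 1) ^ (-θ) * starMass Λ a v := by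
    rcases Nat.eq_zero_or_pos k with hk0 | hkpos
    · subst hk0
      have htriv : ‖Sv‖ ≤ 1 / 2 * starMass Λ a v := by
        rw [hSv, starMass, Finset.mul_sum]
        refine (norm_sum_le _ _).trans (Finset.sum_le_sum fun t ht => ?_)
        have hadj : hexGraph.Adj v t := (Finset.mem_filter.1 ht).2
        rw [norm_mul, Complex.norm_conj]
        exact mul_le_mul (norm_hexMidpoint_sub_hexCenter_le hadj)
          (GateMass.norm_obs_le_norm_obs_zero Λ a (5 / 8) s(v, t)) (norm_nonneg _) (by norm_num)
      refine htriv.trans ?_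
      simp only [Nat.cast_zero, zero_add, Real.one_rpow, mul_one]
      exact mul_le_mul_of_nonneg_right (le_max_left _ _) hstar0
    · have hR1 : (1 : ℝ) ≤ ((k : ℝ) + 1) / 2 := by
        have : (1 : ℝ) ≤ k := by exact_mod_cast hkpos
        linarith
      have hdeep : ∀ y : HexVertex, dist (hexCenter y) (hexCenter v) ≤ ((k : ℝ) + 1) / 2 → y ∈ Λ := by
        intro y hy
        refine hk.1 y (hy.trans ?_)
        have : (1 : ℝ) ≤ k := by exact_mod_cast hkpos
        linarith
      have hD := hDD v (((k : ℝ) + 1) / 2) hR1 hdeep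
      rw [← hSv] at hD
      refine hD.trans ?_
      rw [starMass]
      refine mul_le_mul_of_nonneg_right ?_ (Finset.sum_nonneg fun _ _ => norm_nonneg _)
      have hk1 : (0 : ℝ) < (k : ℝ) + 1 := by positivity
      have hrpow : (((k : ℝ) + 1) / 2) ^ (-θ) = 2 ^ θ * ((k : ℝ) + 1) ^ (-θ) := by
        rw [Real.div_rpow hk1.le (by norm_num), Real.rpow_neg (by norm_num : (0:ℝ) ≤ 2),
          Real.rpow_neg hk1.le, div_inv_eq_mul, mul_comm]
      rw [hrpow, ← mul_assoc]
      exact mul_le_mul_of_nonneg_right (le_max_right _ _) (Real.rpow_nonneg hk1.le _)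
  have h1 := mul_le_mul_of_nonneg_left hSbound hMψ
  nlinarith [h1]

/-- **Twist weight at an `R`-deep vertex** (`R ≥ 1`): `Mψ ‖S_v‖ + (Lδ/4) starMass ≤
(Mψ C R^{-θ} + Lδ/4) · starMass`. [cite: DuminilCopinSmirnov2012, §3 (summation by parts)] -/
theorem twistWeight_le_of_deep {Λ : Finset HexVertex} {a : Sym2 HexVertex} {C θ : ℝ}
    (hDD : ∀ (v : HexVertex) (R : ℝ), 1 ≤ R →
      (∀ y : HexVertex, dist (hexCenter y) (hexCenter v) ≤ R → y ∈ Λ) →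
      ‖∑ t ∈ Λ.filter (fun t => hexGraph.Adj v t), conj (hexMidpoint s(v, t) - hexCenter v) *
          hexParafermionicObservable Λ a hexCriticalFugacity (5 / 8) s(v, t)‖ ≤
        C * R ^ (-θ) * ∑ t ∈ Λ.filter (fun t => hexGraph.Adj v t),
          ‖hexParafermionicObservable Λ a hexCriticalFugacity 0 s(v, t)‖)
    {Mψ L δ R : ℝ} (hMψ : 0 ≤ Mψ) (hR : 1 ≤ R) {v : HexVertex}
    (hdeep : ∀ y : HexVertex, dist (hexCenter y) (hexCenter v) ≤ R → y ∈ Λ) :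
    Mψ * ‖∑ t ∈ Λ.filter (fun t => hexGraph.Adj v t), conj (hexMidpoint s(v, t) - hexCenter v) *
        hexParafermionicObservable Λ a hexCriticalFugacity (5 / 8) s(v, t)‖ + L * δ / 4 * starMass Λ a v ≤
      (Mψ * C * R ^ (-θ) + L * δ / 4) * starMass Λ a v := by
  have hD := hDD v R hR hdeep
  have h1 := mul_le_mul_of_nonneg_left hD hMψ
  rw [starMass]
  nlinarith [h1]

/-! ### 3. The mass in the Taylor remainder -/

/-- **Remainder mass versus star masses.** The `b`-normalised mass of the up-oriented interior edges
whose scaled midpoint lies in the `r`-thickening of `S` is at most `δ²/‖F(b)‖` times the total star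
mass of the vertices of `Λ` with scaled centre in the `(r + δ/2)`-thickening of `S` (each such edge
lies in the star of its up endpoint, within `δ/2`; `‖F_{5/8}‖ ≤ Z`). [cite: DuminilCopinSmirnov2012, Def. 1] -/
theorem remainder_vertex_le (Λ : Finset HexVertex) (a b : Sym2 HexVertex) {δ r : ℝ} (S : Set ℂ)
    (hδ : 0 ≤ δ) (hr : 0 ≤ r) :
    ∑ v ∈ Λ.filter (fun v => v.2 = 0), ∑ t ∈ Λ.filter (fun t => hexGraph.Adj v t),
        (cthickening r S).indicator
          (fun _ => ‖(δ : ℂ) ^ 2 * hexParafermionicObservable Λ a hexCriticalFugacity (5 / 8) s(v, t) /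
            hexParafermionicObservable Λ a hexCriticalFugacity (5 / 8) b‖) ((δ : ℂ) * hexMidpoint s(v, t)) ≤
      δ ^ 2 / ‖hexParafermionicObservable Λ a hexCriticalFugacity (5 / 8) b‖ *
        ∑ v ∈ Λ.filter (fun v => (δ : ℂ) * hexCenter v ∈ cthickening (r + δ / 2) S), starMass Λ a v := by
  classical
  set F := hexParafermionicObservable Λ a hexCriticalFugacity (5 / 8) with hF
  set Z := hexParafermionicObservable Λ a hexCriticalFugacity 0 with hZ
  set W : HexVertex → ℝ := fun v =>
    if (δ : ℂ) * hexCenter v ∈ cthickening (r + δ / 2) S then starMass Λ a v else 0 with hW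
  have hstar0 : ∀ v, 0 ≤ starMass Λ a v := fun v => Finset.sum_nonneg fun t _ => norm_nonneg _
  have hW0 : ∀ v, 0 ≤ W v := fun v => by simp only [hW]; split_ifs; exacts [hstar0 v, le_rfl]
  have hvertex : ∀ v ∈ Λ.filter (fun v => v.2 = 0), ∑ t ∈ Λ.filter (fun t => hexGraph.Adj v t),
      (cthickening r S).indicator (fun _ => ‖(δ : ℂ) ^ 2 * F s(v, t) / F b‖)
        ((δ : ℂ) * hexMidpoint s(v, t)) ≤ δ ^ 2 / ‖F b‖ * W v := by
    intro v _
    by_cases hvb : (δ : ℂ) * hexCenter v ∈ cthickening (r + δ / 2) S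
    · have hWv : W v = starMass Λ a v := by simp only [hW, if_pos hvb]
      rw [hWv, starMass, Finset.mul_sum]
      refine Finset.sum_le_sum fun t _ => ?_
      have hle : ‖(δ : ℂ) ^ 2 * F s(v, t) / F b‖ ≤ δ ^ 2 / ‖F b‖ * ‖Z s(v, t)‖ := by
        rw [norm_div, norm_mul, norm_pow, Complex.norm_real, Real.norm_of_nonneg hδ, div_eq_mul_inv,
          div_eq_mul_inv]
        have := GateMass.norm_obs_le_norm_obs_zero Λ a (5 / 8) s(v, t)
        have h0 : 0 ≤ (‖F b‖)⁻¹ := inv_nonneg.2 (norm_nonneg _)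
        nlinarith [norm_nonneg (F s(v, t)), sq_nonneg δ, mul_nonneg (sq_nonneg δ) h0]
      by_cases hm : (δ : ℂ) * hexMidpoint s(v, t) ∈ cthickening r S
      · rw [indicator_of_mem hm]; exact hle
      · rw [indicator_of_notMem hm]
        exact mul_nonneg (div_nonneg (sq_nonneg _) (norm_nonneg _)) (norm_nonneg _)
    · have hWv : W v = 0 := by simp only [hW, if_neg hvb]
      rw [hWv, mul_zero]
      refine (Finset.sum_eq_zero fun t ht => ?_).le
      have hadj : hexGraph.Adj v t := (Finset.mem_filter.1 ht).2
      refine indicator_of_notMem (fun hm => hvb ?_) _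
      have h2 : dist ((δ : ℂ) * hexCenter v) ((δ : ℂ) * hexMidpoint s(v, t)) ≤ δ / 2 := by
        rw [dist_comm, dist_smul_mesh hδ, dist_eq_norm]
        exact (mul_le_mul_of_nonneg_left (norm_hexMidpoint_sub_hexCenter_le hadj) hδ).trans (by linarith)
      have h3 : (δ : ℂ) * hexCenter v ∈ cthickening (δ / 2) (cthickening r S) :=
        mem_cthickening_of_dist_le _ _ _ _ hm h2
      have h4 := cthickening_cthickening_subset (by linarith : 0 ≤ δ / 2) hr S h3
      rwa [show δ / 2 + r = r + δ / 2 by ring] at h4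
  calc ∑ v ∈ Λ.filter (fun v => v.2 = 0), ∑ t ∈ Λ.filter (fun t => hexGraph.Adj v t),
        (cthickening r S).indicator (fun _ => ‖(δ : ℂ) ^ 2 * F s(v, t) / F b‖) ((δ : ℂ) * hexMidpoint s(v, t))
      ≤ ∑ v ∈ Λ.filter (fun v => v.2 = 0), δ ^ 2 / ‖F b‖ * W v := Finset.sum_le_sum hvertex
    _ ≤ ∑ v ∈ Λ, δ ^ 2 / ‖F b‖ * W v :=
        Finset.sum_le_sum_of_subset_of_nonneg (Finset.filter_subset _ _) fun v _ _ =>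
          mul_nonneg (div_nonneg (sq_nonneg _) (norm_nonneg _)) (hW0 v)
    _ = δ ^ 2 / ‖F b‖ * ∑ v ∈ Λ.filter (fun v => (δ : ℂ) * hexCenter v ∈ cthickening (r + δ / 2) S),
          starMass Λ a v := by
        rw [← Finset.mul_sum, Finset.sum_filter]

/-! ### Registered form (sub-goal of `polygonGreenPairing`) -/

/-- **Registered sub-goal `polygonGreen_twistedVertex`** (crux item stmt-CriticalPhenomena-14004, line
`polygon-parity-squeeze`, stub `polygonGreenPairing`, mechanism (A1a)): registry form (one `∀`-term) of
`twisted_vertex_le` — the twisted term of the Green identity at one mesh, reduced to the conjugated star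
sums and star masses of the vertices near the support. [cite: DuminilCopinSmirnov2012, §3 (summation by parts)] -/
theorem polygonGreen_twistedVertex : ∀ (Λ : Finset HexVertex) (a b : Sym2 HexVertex) (δ Mψ L : ℝ) (ψ : ℂ → ℂ) (S : Set ℂ), 0 ≤ δ → (∀ z, ‖ψ z‖ ≤ Mψ) → 0 ≤ L → (∀ x y, ‖ψ x - ψ y‖ ≤ L * ‖x - y‖) → (∀ z, ψ z ≠ 0 → z ∈ S) → ‖∑ v ∈ Λ.filter (fun v => v.2 = 0), ∑ t ∈ Λ.filter (fun t => hexGraph.Adj v t), 12 * (hexMidpoint s(v, t) - hexCenter v) ^ 2 * ψ ((δ : ℂ) * hexMidpoint s(v, t)) * ((δ : ℂ) ^ 2 * hexParafermionicObservable Λ a hexCriticalFugacity (5 / 8) s(v, t) / hexParafermionicObservable Λ a hexCriticalFugacity (5 / 8) b)‖ ≤ 6 * (δ ^ 2 / ‖hexParafermionicObservable Λ a hexCriticalFugacity (5 / 8) b‖) * ∑ v ∈ Λ.filter (fun v => (δ : ℂ) * hexCenter v ∈ Metric.cthickening (δ / 2) S), (Mψ * ‖∑ t ∈ Λ.filter (fun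 t => hexGraph.Adj v t), (starRingEnd ℂ) (hexMidpoint s(v, t) - hexCenter v) * hexParafermionicObservable Λ a hexCriticalFugacity (5 / 8) s(v, t)‖ + L * δ / 4 * starMass Λ a v) :=
  fun Λ a b _ _ _ _ _ hδ hMψ hL hψL hψs => twisted_vertex_le Λ a b hδ hMψ hL hψL hψs

end Summit.CriticalPhenomena.SAWScalingLimit.Theorems.PolygonParitySqueeze.PolygonGreen

end
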